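import Summits.KontsevichZagierPeriods.KontsevichZagierPeriods.Theses.HurwitzMicroSectors
import Summits.KontsevichZagierPeriods.KontsevichZagierPeriods.Theorems.HurwitzMicroSectorsNormalFormPrinciplePiBoxTransfer
import Summits.KontsevichZagierPeriods.KontsevichZagierPeriods.Theorems.HurwitzMicroSectorsNormalFormPrincipleVariants2239
import Summits.KontsevichZagierPeriods.KontsevichZagierPeriods.Theorems.HurwitzMicroSectorsNormalFormPrincipleVariants2320

/-! TTRL-lite variant V2282 of stmt-KontsevichZagierPeriods-3869

Variant V2282 = `stub_boxRigidity` (the leaf `BoxRigidity` of `NormalFormPrinciple`: two BOX-RATIONAL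
representations — domain the open unit box, integrand `p/q` over `ℚ`, `q ≠ 0` on the box — with equal
values are KZ-equivalent) under the move `bound_nat:m≤4; bound_nat:m'≤8`. Verdict of the attempt seat:
**open** — this file is the exact-strength certificate, not a proof of the variant. A joint bound is one
dimension (`boxRigidityLe_iff_boxVanishing`, file `…Variants2239`, instance `j = 4`, `k = 8`): the
variant is EXACTLY BoxVanishing in dimension `max 4 8 = 8` — every box-rational representation on
`(0,1)⁸` of value `0` is a KZ relation (`stub_boxRigidity_var2282_iff_boxVanishing_eight`); equivalently
BoxRigidity under the joint bound `m, m' ≤ 8` (`stub_boxRigidity_var2282_iff_le_eight`, verbatim the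
right-hand side of the sibling certificate `stub_boxRigidity_var2320_iff_le_eight`, so V2282 coincides with
V2320 = `fix_nat:m=8; bound_nat:m'≤2`: `stub_boxRigidity_var2282_iff_var2320`), and the bound `m ≤ 4` is
idle once `m' ≤ 8` is allowed (`Equivalent` is symmetric: `stub_boxRigidity_var2282_iff_swap`). It implies
BoxVanishing in every dimension `≤ 8` (`boxVanishing_le_eight_of_stub_boxRigidity_var2282`), whose level
`2` (every vanishing absolutely convergent `∫∫_{(0,1)²} p/q`, `p, q ∈ ℚ[x,y]`, is generated by the four
moves: Catalan's `G` versus `π²`, `Li₂` at rationals, `log·log`, `L(2,χ)` …) is open, and whose level `8`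
adds `ζ(5)`, `ζ(7)`, `ζ(3)²` versus `π⁶`, `ζ(3,5)`; the tree proves dimension `≤ 1` only
(`boxRigidity_of_le_one`, Baker). Every side condition of a move is a sentence of the theory of real
closed fields over `ℚ`, independent of the value, so a uniform proof at level `8` must, for
`[(0,1)⁵, a + b/(1 − x₁⋯x₅)]` (value `a + b ζ(5)`), either refute `a + b ζ(5) = 0` or exhibit a chain
(forcing it by soundness): an irrationality proof of `ζ(5)` — open. Conversely
`KontsevichZagierPeriods ⇒ parent ⇒ V2282` (`stub_boxRigidity_var2282_of_statement`), so a refutation of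
the variant would refute the Summit, and no invariant of `KZ.relations` finer than `eval` is known
(soundness `relations_le_ker_eval_holds` is the only one in the tree).
Residual goal (verbatim, `lean check`): `M : IntegralRep 8, hMd : M.domain = {x | ∀ i, x i ∈ Ioo 0 1},
hMr : M.IsRational, hv : M.value = 0 ⊢ of M ∈ relations`.
Source: M. Kontsevich, D. Zagier, *Periods* (2001), §1.2 Conjecture 1. Pure proof file, no definitions. -/

-- `Summit.<Summit>.<Problem>` is the tree's mandated summit-side namespace (CONVENTIONS §2); for this
-- single-conjunct summit the two coincide, so the duplicate is deliberate.
set_option linter.dupNamespace false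

noncomputable section

namespace Summit.KontsevichZagierPeriods.KontsevichZagierPeriods.Theorems

open MeasureTheory Set
open Literature.NumberTheory.Transcendental Literature.NumberTheory.Transcendental.KZ
open Summit.KontsevichZagierPeriods.KontsevichZagierPeriods.Theses.HurwitzMicroSectors
open Summit.KontsevichZagierPeriods.HurwitzMicroSectors.NormalFormPrinciple.PiBox

/-! ## The variant V2282: exactly `BoxVanishing 8` -/

/-- **V2282 ⟺ BoxVanishing in dimension `8`** (every box-rational representation on `(0,1)⁸` of
value `0` is a KZ relation): instance `j = 4`, `k = 8` of `boxRigidityLe_iff_boxVanishing`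
(`max 4 8 = 8`). [cite: KontsevichZagier2001, §1.2 Conjecture 1] -/
theorem stub_boxRigidity_var2282_iff_boxVanishing_eight :
    (∀ (m m' : ℕ) (N : IntegralRep m) (N' : IntegralRep m'), m' ≤ 8 → m ≤ 4 → N.domain = {x | ∀ i, x i ∈ Set.Ioo (0:ℝ) 1} → N.IsRational → N'.domain = {x | ∀ i, x i ∈ Set.Ioo (0:ℝ) 1} → N'.IsRational → N.value = N'.value → Equivalent N N') ↔
    (∀ (M : IntegralRep 8), M.domain = {x | ∀ i, x i ∈ Set.Ioo (0:ℝ) 1} → M.IsRational →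
      M.value = 0 → of M ∈ relations) :=
  boxRigidityLe_iff_boxVanishing 4 8

/-- **V2282 ⟺ BoxRigidity under the joint bound `m, m' ≤ 8`** (the honest strength of the variant:
the bound `m ≤ 4` loses nothing once `m' ≤ 8` is allowed, `Equivalent` being symmetric; this
right-hand side is verbatim that of `stub_boxRigidity_var2320_iff_le_eight`).
[cite: KontsevichZagier2001, §1.2 Conjecture 1] -/
theorem stub_boxRigidity_var2282_iff_le_eight :
    (∀ (m m' : ℕ) (N : IntegralRep m) (N' : IntegralRep m'), m' ≤ 8 → m ≤ 4 → N.domain = {x | ∀ i, x i ∈ Set.Ioo (0:ℝ) 1} → N.IsRational → N'.domain = {x | ∀ i, x i ∈ Set.Ioo (0:ℝ) 1} → N'.IsRational → N.value = N'.value → Equivalent N N') ↔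
    (∀ (m m' : ℕ) (N : IntegralRep m) (N' : IntegralRep m'), m' ≤ 8 → m ≤ 8 →
      N.domain = {x | ∀ i, x i ∈ Set.Ioo (0:ℝ) 1} → N.IsRational →
      N'.domain = {x | ∀ i, x i ∈ Set.Ioo (0:ℝ) 1} → N'.IsRational →
      N.value = N'.value → Equivalent N N') := by
  rw [stub_boxRigidity_var2282_iff_boxVanishing_eight]
  exact ⟨fun hvan => boxRigidityLe_of_boxVanishing (j := 8) (k := 8) le_rfl le_rfl hvan,
    fun h => boxVanishing_of_boxRigidityLe (j := 8) (k := 8) le_rfl h⟩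

/-- **V2282 ⟺ its sibling V2320** (`fix_nat:m=8; bound_nat:m'≤2`): both are BoxVanishing `8`, so the
two-sided variants of maximal dimension `8` all coincide. [cite: KontsevichZagier2001, §1.2 Conjecture 1] -/
theorem stub_boxRigidity_var2282_iff_var2320 :
    (∀ (m m' : ℕ) (N : IntegralRep m) (N' : IntegralRep m'), m' ≤ 8 → m ≤ 4 → N.domain = {x | ∀ i, x i ∈ Set.Ioo (0:ℝ) 1} → N.IsRational → N'.domain = {x | ∀ i, x i ∈ Set.Ioo (0:ℝ) 1} → N'.IsRational → N.value = N'.value → Equivalent N N') ↔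
    (∀ (m' : ℕ) (N : IntegralRep 8) (N' : IntegralRep m'), m' ≤ 2 → N.domain = {x | ∀ i, x i ∈ Set.Ioo (0:ℝ) 1} → N.IsRational → N'.domain = {x | ∀ i, x i ∈ Set.Ioo (0:ℝ) 1} → N'.IsRational → N.value = N'.value → Equivalent N N') := by
  rw [stub_boxRigidity_var2282_iff_boxVanishing_eight, stub_boxRigidity_var2320_iff_boxVanishing_eight]

/-- **V2282 ⟺ its mirror `bound_nat:m≤8; bound_nat:m'≤4`** (the bounds read on the other side):
`Equivalent` is symmetric, so which side carries the larger bound is immaterial.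
[cite: KontsevichZagier2001, §1.2 Conjecture 1] -/
theorem stub_boxRigidity_var2282_iff_swap :
    (∀ (m m' : ℕ) (N : IntegralRep m) (N' : IntegralRep m'), m' ≤ 8 → m ≤ 4 → N.domain = {x | ∀ i, x i ∈ Set.Ioo (0:ℝ) 1} → N.IsRational → N'.domain = {x | ∀ i, x i ∈ Set.Ioo (0:ℝ) 1} → N'.IsRational → N.value = N'.value → Equivalent N N') ↔
    (∀ (m m' : ℕ) (N : IntegralRep m) (N' : IntegralRep m'), m' ≤ 4 → m ≤ 8 →
      N.domain = {x | ∀ i, x i ∈ Set.Ioo (0:ℝ) 1} → N.IsRational →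
      N'.domain = {x | ∀ i, x i ∈ Set.Ioo (0:ℝ) 1} → N'.IsRational →
      N.value = N'.value → Equivalent N N') :=
  ⟨fun h m m' N N' hm' hm hNd hNr hN'd hN'r hv => (h m' m N' N hm hm' hN'd hN'r hNd hNr hv.symm).symm,
    fun h m m' N N' hm' hm hNd hNr hN'd hN'r hv => (h m' m N' N hm hm' hN'd hN'r hNd hNr hv.symm).symm⟩

/-- **V2282 ⇒ BoxVanishing in every dimension `≤ 8`** (monotonicity along padding,
`boxVanishing_mono`); the first open level is `2`. [cite: KontsevichZagier2001, §1.2 Conjecture 1] -/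
theorem boxVanishing_le_eight_of_stub_boxRigidity_var2282
    (h : ∀ (m m' : ℕ) (N : IntegralRep m) (N' : IntegralRep m'), m' ≤ 8 → m ≤ 4 → N.domain = {x | ∀ i, x i ∈ Set.Ioo (0:ℝ) 1} → N.IsRational → N'.domain = {x | ∀ i, x i ∈ Set.Ioo (0:ℝ) 1} → N'.IsRational → N.value = N'.value → Equivalent N N')
    {j : ℕ} (hj : j ≤ 8) (N : IntegralRep j) (hNd : N.domain = {x | ∀ i, x i ∈ Set.Ioo (0:ℝ) 1})
    (hNr : N.IsRational) (hv : N.value = 0) : of N ∈ relations :=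
  boxVanishing_mono hj (stub_boxRigidity_var2282_iff_boxVanishing_eight.1 h) N hNd hNr hv

/-- **BoxVanishing `8` ⇒ V2282** (the form in which a future proof of the dimension-`8` kernel
statement would be consumed). [cite: KontsevichZagier2001, §1.2 Conjecture 1] -/
theorem stub_boxRigidity_var2282_of_boxVanishing_eight
    (hvan : ∀ (M : IntegralRep 8), M.domain = {x | ∀ i, x i ∈ Set.Ioo (0:ℝ) 1} → M.IsRational →
      M.value = 0 → of M ∈ relations) :
    ∀ (m m' : ℕ) (N : IntegralRep m) (N' : IntegralRep m'), m' ≤ 8 → m ≤ 4 → N.domain = {x | ∀ i, x i ∈ Set.Ioo (0:ℝ) 1} → N.IsRational → N'.domain = {x | ∀ i, x i ∈ Set.Ioo (0:ℝ) 1} → N'.IsRational → N.value = N'.value → Equivalent N N' :=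
  stub_boxRigidity_var2282_iff_boxVanishing_eight.2 hvan

/-- **The parent leaf ⇒ V2282** (specialisation: both bounds are dropped).
[cite: KontsevichZagier2001, §1.2 Conjecture 1] -/
theorem stub_boxRigidity_var2282_of_parent
    (h : ∀ (m m' : ℕ) (N : IntegralRep m) (N' : IntegralRep m'), N.domain = {x | ∀ i, x i ∈ Set.Ioo (0:ℝ) 1} → N.IsRational → N'.domain = {x | ∀ i, x i ∈ Set.Ioo (0:ℝ) 1} → N'.IsRational → N.value = N'.value → Equivalent N N') :
    ∀ (m m' : ℕ) (N : IntegralRep m) (N' : IntegralRep m'), m' ≤ 8 → m ≤ 4 → N.domain = {x | ∀ i, x i ∈ Set.Ioo (0:ℝ) 1} → N.IsRational → N'.domain = {x | ∀ i, x i ∈ Set.Ioo (0:ℝ) 1} → N'.IsRational → N.value = N'.value → Equivalent N N' :=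
  fun m m' N N' _ _ => h m m' N N'

/-- **`KontsevichZagierPeriods ⇒ V2282`**: the variant is a special case of Conjecture 1 for the
tree's calculus (`leaves_of_statement`) — so a refutation of the variant would refute the Summit.
[cite: KontsevichZagier2001, §1.2 Conjecture 1] -/
theorem stub_boxRigidity_var2282_of_statement (h : _root_.KontsevichZagierPeriods) :
    ∀ (m m' : ℕ) (N : IntegralRep m) (N' : IntegralRep m'), m' ≤ 8 → m ≤ 4 → N.domain = {x | ∀ i, x i ∈ Set.Ioo (0:ℝ) 1} → N.IsRational → N'.domain = {x | ∀ i, x i ∈ Set.Ioo (0:ℝ) 1} → N'.IsRational → N.value = N'.value → Equivalent N N' :=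
  stub_boxRigidity_var2282_of_parent (leaves_of_statement h).1

end Summit.KontsevichZagierPeriods.KontsevichZagierPeriods.Theorems

end
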